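import Literature.NumberTheory.Transcendental.ChudnovskyAnalytic
import Literature.NumberTheory.Transcendental.ChudnovskyHeights
import HarnessLib

/-!
# Chudnovsky's theorem on periods — degrees and heights of the formal values

Topic `Literature/NumberTheory/Transcendental` (trunk T-TRANSCEND). Node [VAL] of the proof of
`Literature.NumberTheory.Transcendental.Chudnovsky1984_thm_7_3_1` (Chudnovsky 1984, Ch. 7, Theorem 3.1), companion of
`ChudnovskyAnalytic.lean`, Part II (the polynomials `V j m i k`) and `ChudnovskyHeights.lean`
(the `ℓ¹`-norm `l1`).

Chudnovsky 1984, Ch. 7, §2, p. 306: the numbers `F^{(k)}(z₀)` are values of integer polynomials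
whose degree is `O(L)` and whose height is `exp O(L log L)`. Here this is made explicit for the
formal values `V j m i k = (D₀^j (X₀ⁱX₁ᵏ))(m a₂, a₃, 0; a)`: `deg V ≤ i + k + j` and
`l1 V ≤ (7(i+k+j))^j (m+1)^{i+k+j}`. The proof is generic bookkeeping for a derivation
`D = mkDerivation ℤ f` of `ℤ[X_σ]` whose values `f s` have degree `≤ 2` and `ℓ¹`-norm `≤ B`:
`deg (D Q) ≤ deg Q + 1` and `l1 (D Q) ≤ B · deg Q · l1 Q`, followed by a substitution of
polynomials of degree `≤ 1`.

## Contents (no definitions)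

* `totalDegree_mkDerivation_le`, `l1_mkDerivation_le`, and their iterates
  `totalDegree_mkDerivation_pow_le`, `l1_mkDerivation_pow_le`.
* `totalDegree_aeval_le_of_le_one`, `l1_aeval_le` — substitution bounds.
* `totalDegree_V_le`, `degree_le_of_mem_support_V`, `l1_V_le` — the bounds for `V j m i k`.
-/

noncomputable section

open MvPolynomial Finset

namespace Literature.NumberTheory.Transcendental.Chudnovsky

section Generic

variable {σ τ : Type*}

/-- `l1 (c • P) ≤ |c| · l1 P` for an integer scalar. [folklore] -/
lemma l1_zsmul_le (c : ℤ) (P : MvPolynomial σ ℤ) : l1 (c • P) ≤ |(c : ℝ)| * l1 P := by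
  rw [MvPolynomial.smul_eq_C_mul]
  refine (wnorm_mul_le _ _ _).trans ?_
  rw [wnorm_C, normRingSeminorm_int_apply]

/-- Removing one from a multi-index in its support lowers the degree by one. [folklore] -/
lemma degree_sub_single {α : σ →₀ ℕ} {s : σ} (hs : s ∈ α.support) :
    (α - Finsupp.single s 1).degree + 1 = α.degree := by
  classical
  have hle : Finsupp.single s 1 ≤ α := by
    rw [Finsupp.single_le_iff]
    exact Nat.one_le_iff_ne_zero.mpr (Finsupp.mem_support_iff.mp hs)
  conv_rhs => rw [← tsub_add_cancel_of_le hle]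
  rw [map_add, Finsupp.degree_single]

variable (f : σ → MvPolynomial σ ℤ) {B : ℝ}

/-- **Degree under a derivation.** If all `deg (f s) ≤ 2` then
`deg (D_f Q) ≤ deg Q + 1` for `D_f = mkDerivation ℤ f`. [folklore] -/
theorem totalDegree_mkDerivation_le (hf : ∀ s, (f s).totalDegree ≤ 2) (Q : MvPolynomial σ ℤ) :
    (MvPolynomial.mkDerivation ℤ f Q).totalDegree ≤ Q.totalDegree + 1 := by
  classical
  conv_lhs => rw [Q.as_sum, map_sum]
  refine totalDegree_finsetSum_le fun α hα => ?_
  rw [MvPolynomial.mkDerivation_monomial, Finsupp.sum]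
  refine (totalDegree_smul_le _ _).trans (totalDegree_finsetSum_le fun s hs => ?_)
  rw [smul_eq_mul]
  refine (totalDegree_mul _ _).trans ?_
  have h1 : (monomial (α - Finsupp.single s 1) ((α s : ℕ) : ℤ) : MvPolynomial σ ℤ).totalDegree ≤
      (α - Finsupp.single s 1).degree := totalDegree_monomial_le _ _
  have h2 := degree_sub_single hs
  have h3 : α.degree ≤ Q.totalDegree := le_totalDegree hα
  have h4 := hf s
  omega

/-- **Height under a derivation.** If all `l1 (f s) ≤ B` then `l1 (D_f Q) ≤ B · deg Q · l1 Q`.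
[folklore] -/
theorem l1_mkDerivation_le (hB : 0 ≤ B) (hf : ∀ s, l1 (f s) ≤ B) (Q : MvPolynomial σ ℤ) :
    l1 (MvPolynomial.mkDerivation ℤ f Q) ≤ B * Q.totalDegree * l1 Q := by
  classical
  conv_lhs => rw [Q.as_sum, map_sum]
  refine (wnorm_sum_le _ _ _).trans ?_
  have hterm : ∀ α ∈ Q.support, l1 (MvPolynomial.mkDerivation ℤ f (monomial α (Q.coeff α))) ≤
      |((Q.coeff α : ℤ) : ℝ)| * (B * Q.totalDegree) := by
    intro α hα
    rw [MvPolynomial.mkDerivation_monomial, Finsupp.sum]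
    refine (l1_zsmul_le _ _).trans (mul_le_mul_of_nonneg_left ?_ (abs_nonneg _))
    refine (wnorm_sum_le _ _ _).trans ?_
    calc ∑ s ∈ α.support, wnorm (normRingSeminorm ℤ)
          ((monomial (α - Finsupp.single s 1) ((α s : ℕ) : ℤ) : MvPolynomial σ ℤ) • f s)
        ≤ ∑ s ∈ α.support, (α s : ℝ) * B := by
          refine Finset.sum_le_sum fun s _ => ?_
          rw [smul_eq_mul]
          refine (wnorm_mul_le _ _ _).trans ?_
          rw [wnorm_monomial, normRingSeminorm_int_apply, Int.cast_natCast, Nat.abs_cast]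
          exact mul_le_mul_of_nonneg_left (hf s) (Nat.cast_nonneg _)
      _ = (α.degree : ℝ) * B := by
          rw [← Finset.sum_mul, Finsupp.degree_apply, Nat.cast_sum]
      _ ≤ B * Q.totalDegree := by
          rw [mul_comm]
          gcongr
          exact_mod_cast (le_totalDegree hα : α.degree ≤ Q.totalDegree)
  calc ∑ α ∈ Q.support, wnorm (normRingSeminorm ℤ)
        (MvPolynomial.mkDerivation ℤ f (monomial α (Q.coeff α)))
      ≤ ∑ α ∈ Q.support, |((Q.coeff α : ℤ) : ℝ)| * (B * Q.totalDegree) := Finset.sum_le_sum hterm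
    _ = B * Q.totalDegree * l1 Q := by
        rw [← Finset.sum_mul, mul_comm]
        unfold l1 wnorm
        simp only [normRingSeminorm_int_apply]

/-- Degree of the iterates: `deg (D_f^j Q) ≤ deg Q + j`. [folklore] -/
theorem totalDegree_mkDerivation_pow_le (hf : ∀ s, (f s).totalDegree ≤ 2) (j : ℕ)
    (Q : MvPolynomial σ ℤ) :
    (((MvPolynomial.mkDerivation ℤ f).toLinearMap ^ j) Q).totalDegree ≤ Q.totalDegree + j := by
  induction j with
  | zero => simp
  | succ j ih =>
    rw [pow_succ', Module.End.mul_apply]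
    exact (totalDegree_mkDerivation_le f hf _).trans (by omega)

/-- Height of the iterates: `l1 (D_f^j Q) ≤ (B (deg Q + j))^j · l1 Q`. [folklore] -/
theorem l1_mkDerivation_pow_le (hB : 0 ≤ B) (hf : ∀ s, l1 (f s) ≤ B)
    (hf' : ∀ s, (f s).totalDegree ≤ 2) (j : ℕ) (Q : MvPolynomial σ ℤ) :
    l1 (((MvPolynomial.mkDerivation ℤ f).toLinearMap ^ j) Q) ≤
      (B * (Q.totalDegree + j)) ^ j * l1 Q := by
  induction j with
  | zero => simp
  | succ j ih =>
    rw [pow_succ', Module.End.mul_apply]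
    set P := ((MvPolynomial.mkDerivation ℤ f).toLinearMap ^ j) Q
    have hdeg : (P.totalDegree : ℝ) ≤ Q.totalDegree + j := by
      exact_mod_cast totalDegree_mkDerivation_pow_le f hf' j Q
    have hl1P : 0 ≤ l1 P := wnorm_nonneg _ _
    calc l1 (MvPolynomial.mkDerivation ℤ f P) ≤ B * P.totalDegree * l1 P :=
          l1_mkDerivation_le f hB hf P
      _ ≤ B * (Q.totalDegree + j) * ((B * (Q.totalDegree + j)) ^ j * l1 Q) := by
          gcongr
      _ ≤ (B * (Q.totalDegree + (j + 1 : ℕ))) ^ (j + 1) * l1 Q := by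
          rw [pow_succ]
          have h1 : B * (Q.totalDegree + j) ≤ B * (Q.totalDegree + (j + 1 : ℕ)) := by
            gcongr; linarith
          have h0 : 0 ≤ B * (Q.totalDegree + j) := by positivity
          have h2 : (B * (Q.totalDegree + j)) ^ j ≤ (B * (Q.totalDegree + (j + 1 : ℕ))) ^ j :=
            pow_le_pow_left₀ h0 h1 j
          have hl1Q : 0 ≤ l1 Q := wnorm_nonneg _ _
          calc B * (Q.totalDegree + j) * ((B * (Q.totalDegree + j)) ^ j * l1 Q)
              = (B * (Q.totalDegree + j)) ^ j * (B * (Q.totalDegree + j)) * l1 Q := by ring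
            _ ≤ (B * (Q.totalDegree + (j + 1 : ℕ))) ^ j * (B * (Q.totalDegree + (j + 1 : ℕ))) *
                  l1 Q := by gcongr

/-- **Degree under substitution** of polynomials of degree `≤ 1`. [folklore] -/
theorem totalDegree_aeval_le_of_le_one (w : σ → MvPolynomial τ ℤ)
    (hw : ∀ s, (w s).totalDegree ≤ 1) (Q : MvPolynomial σ ℤ) :
    (MvPolynomial.aeval w Q).totalDegree ≤ Q.totalDegree := by
  classical
  rw [MvPolynomial.aeval_def, MvPolynomial.eval₂_eq]
  refine totalDegree_finsetSum_le fun α hα => ?_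
  refine (totalDegree_mul _ _).trans ?_
  rw [MvPolynomial.algebraMap_eq, totalDegree_C, zero_add]
  refine (totalDegree_finsetProd _ _).trans ?_
  calc ∑ i ∈ α.support, (w i ^ α i).totalDegree ≤ ∑ i ∈ α.support, α i :=
        Finset.sum_le_sum fun i _ => (totalDegree_pow _ _).trans
          (mul_le_of_le_one_right (Nat.zero_le _) (hw i))
    _ = α.degree := (Finsupp.degree_apply α).symm
    _ ≤ Q.totalDegree := (le_totalDegree hα : α.degree ≤ Q.totalDegree)

/-- **Height under substitution**: `l1 (Q(w)) ≤ l1 Q · M^{deg Q}` if all `l1 (w s) ≤ M`, `M ≥ 1`.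
[folklore] -/
theorem l1_aeval_le (w : σ → MvPolynomial τ ℤ) {M : ℝ} (hM : 1 ≤ M) (hw : ∀ s, l1 (w s) ≤ M)
    (Q : MvPolynomial σ ℤ) : l1 (MvPolynomial.aeval w Q) ≤ l1 Q * M ^ Q.totalDegree := by
  classical
  rw [MvPolynomial.aeval_def, MvPolynomial.eval₂_eq, MvPolynomial.algebraMap_eq]
  refine (wnorm_sum_le _ _ _).trans ?_
  have hl1Q : l1 Q = ∑ α ∈ Q.support, |((Q.coeff α : ℤ) : ℝ)| := by
    unfold l1 wnorm; simp only [normRingSeminorm_int_apply]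
  rw [hl1Q, Finset.sum_mul]
  refine Finset.sum_le_sum fun α hα => ?_
  refine (wnorm_mul_le _ _ _).trans ?_
  rw [wnorm_C, normRingSeminorm_int_apply]
  refine mul_le_mul_of_nonneg_left ?_ (abs_nonneg _)
  refine (wnorm_prod_le _ (by simp) _ _).trans ?_
  calc ∏ i ∈ α.support, wnorm (normRingSeminorm ℤ) (w i ^ α i)
      ≤ ∏ i ∈ α.support, M ^ α i :=
        Finset.prod_le_prod (fun i _ => wnorm_nonneg _ _) fun i _ =>
          (wnorm_pow_le _ (by simp) _ _).trans (pow_le_pow_left₀ (wnorm_nonneg _ _) (hw i) _)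
    _ = M ^ α.degree := by rw [Finset.prod_pow_eq_pow_sum, Finsupp.degree_apply]
    _ ≤ M ^ Q.totalDegree := pow_le_pow_right₀ hM (le_totalDegree hα : α.degree ≤ Q.totalDegree)

end Generic

/-! ### The bounds for `V j m i k` -/

/-- The values of `D₀` on the variables have degree `≤ 2`. [folklore] -/
lemma totalDegree_dval_le (s : Fin 3 ⊕ Fin 4) : (dval s).totalDegree ≤ 2 := by
  rcases s with s | l
  · fin_cases s
    · change (-X (Sum.inl 1) - X (Sum.inr 0) : R₇).totalDegree ≤ 2
      refine (totalDegree_sub _ _).trans (max_le ?_ ?_)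
      · rw [totalDegree_neg, totalDegree_X]; norm_num
      · rw [totalDegree_X]; norm_num
    · change (X (Sum.inl 2) : R₇).totalDegree ≤ 2
      rw [totalDegree_X]; norm_num
    · change (6 * X (Sum.inl 1) ^ 2 - X (Sum.inr 1) : R₇).totalDegree ≤ 2
      refine (totalDegree_sub _ _).trans (max_le ?_ ?_)
      · refine (totalDegree_mul _ _).trans ?_
        rw [show (6 : R₇) = C 6 from (map_ofNat C 6).symm, totalDegree_C, totalDegree_X_pow]
      · rw [totalDegree_X]; norm_num
  · change (0 : R₇).totalDegree ≤ 2
    rw [totalDegree_zero]; norm_num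

/-- The values of `D₀` on the variables have `ℓ¹`-norm `≤ 7`. [folklore] -/
lemma l1_dval_le (s : Fin 3 ⊕ Fin 4) : l1 (dval s) ≤ 7 := by
  rcases s with s | l
  · fin_cases s
    · change l1 (-X (Sum.inl 1) - X (Sum.inr 0) : R₇) ≤ 7
      refine (wnorm_sub_le _ _ _).trans ?_
      rw [wnorm_neg, wnorm_X, wnorm_X, normRingSeminorm_int_one]; norm_num
    · change l1 (X (Sum.inl 2) : R₇) ≤ 7
      rw [l1, wnorm_X, normRingSeminorm_int_one]; norm_num
    · change l1 (6 * X (Sum.inl 1) ^ 2 - X (Sum.inr 1) : R₇) ≤ 7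
      refine (wnorm_sub_le _ _ _).trans ?_
      have h6 : l1 (6 * X (Sum.inl 1) ^ 2 : R₇) ≤ 6 := by
        refine (wnorm_mul_le _ _ _).trans ?_
        rw [show (6 : R₇) = C 6 from (map_ofNat C 6).symm, wnorm_C, normRingSeminorm_int_apply]
        have := wnorm_X_pow_le (normRingSeminorm ℤ) (by simp) (Sum.inl 1 : Fin 3 ⊕ Fin 4) 2
        have h0 := wnorm_nonneg (normRingSeminorm ℤ) ((X (Sum.inl 1) : R₇) ^ 2)
        norm_num
        nlinarith
      have hX : l1 (X (Sum.inr 1) : R₇) = 1 := by rw [l1, wnorm_X, normRingSeminorm_int_one]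
      unfold l1 at h6 hX
      linarith
  · change l1 (0 : R₇) ≤ 7
    rw [l1, wnorm_zero]; norm_num

/-- The substitution `sval m` has values of degree `≤ 1`. [folklore] -/
lemma totalDegree_sval_le (m : ℕ) (s : Fin 3 ⊕ Fin 4) : (sval m s).totalDegree ≤ 1 := by
  rcases s with s | l
  · fin_cases s
    · change ((m : R₄) * X 2).totalDegree ≤ 1
      refine (totalDegree_mul _ _).trans ?_
      rw [show (m : R₄) = C (m : ℤ) from (map_natCast C m).symm, totalDegree_C, totalDegree_X]
    · change (X 3 : R₄).totalDegree ≤ 1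
      rw [totalDegree_X]
    · change (0 : R₄).totalDegree ≤ 1
      rw [totalDegree_zero]; norm_num
  · change (X l : R₄).totalDegree ≤ 1
    rw [totalDegree_X]

/-- The substitution `sval m` has values of `ℓ¹`-norm `≤ m + 1`. [folklore] -/
lemma l1_sval_le (m : ℕ) (s : Fin 3 ⊕ Fin 4) : l1 (sval m s) ≤ (m : ℝ) + 1 := by
  rcases s with s | l
  · fin_cases s
    · change l1 ((m : R₄) * X 2) ≤ (m : ℝ) + 1
      refine (wnorm_mul_le _ _ _).trans ?_
      rw [show (m : R₄) = C (m : ℤ) from (map_natCast C m).symm, wnorm_C, wnorm_X,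
        normRingSeminorm_int_apply, normRingSeminorm_int_one]
      simp
    · change l1 (X 3 : R₄) ≤ (m : ℝ) + 1
      rw [l1, wnorm_X, normRingSeminorm_int_one]; linarith [(Nat.cast_nonneg m : (0 : ℝ) ≤ m)]
    · change l1 (0 : R₄) ≤ (m : ℝ) + 1
      rw [l1, wnorm_zero]; positivity
  · change l1 (X l : R₄) ≤ (m : ℝ) + 1
    rw [l1, wnorm_X, normRingSeminorm_int_one]; linarith [(Nat.cast_nonneg m : (0 : ℝ) ≤ m)]

/-- The monomial `X₀ⁱ X₁ᵏ` has degree `i + k` and `ℓ¹`-norm `≤ 1`. [folklore] -/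
lemma totalDegree_monomial_ik (i k : ℕ) :
    (X (Sum.inl 0) ^ i * X (Sum.inl 1) ^ k : R₇).totalDegree ≤ i + k :=
  (totalDegree_mul _ _).trans (by rw [totalDegree_X_pow, totalDegree_X_pow])

/-- `l1 (X₀ⁱ X₁ᵏ) ≤ 1`. [folklore] -/
lemma l1_monomial_ik (i k : ℕ) : l1 (X (Sum.inl 0) ^ i * X (Sum.inl 1) ^ k : R₇) ≤ 1 := by
  refine (wnorm_mul_le _ _ _).trans ?_
  have h1 := wnorm_X_pow_le (normRingSeminorm ℤ) (by simp) (Sum.inl 0 : Fin 3 ⊕ Fin 4) i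
  have h2 := wnorm_X_pow_le (normRingSeminorm ℤ) (by simp) (Sum.inl 1 : Fin 3 ⊕ Fin 4) k
  have h0 := wnorm_nonneg (normRingSeminorm ℤ) ((X (Sum.inl 0) : R₇) ^ i)
  nlinarith

/-- **Degree bound**: `deg (V j m i k) ≤ i + k + j`. [cite: Chudnovsky1984, Ch. 7 §2 p. 306] -/
theorem totalDegree_V_le (j m i k : ℕ) : (V j m i k).totalDegree ≤ i + k + j := by
  unfold V D₀
  refine (totalDegree_aeval_le_of_le_one _ (totalDegree_sval_le m) _).trans ?_
  refine (totalDegree_mkDerivation_pow_le dval totalDegree_dval_le j _).trans ?_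
  have := totalDegree_monomial_ik i k
  omega

/-- The same, monomial-wise: every monomial of `V j m i k` has degree `≤ i + k + j`.
[cite: Chudnovsky1984, Ch. 7 §2 p. 306] -/
theorem degree_le_of_mem_support_V (j m i k : ℕ) {α : Fin 4 →₀ ℕ}
    (hα : α ∈ (V j m i k).support) : α.degree ≤ i + k + j :=
  (le_totalDegree hα : α.degree ≤ (V j m i k).totalDegree).trans (totalDegree_V_le j m i k)

/-- **Height bound**: `l1 (V j m i k) ≤ (7 (i+k+j))^j (m+1)^{i+k+j}`.
[cite: Chudnovsky1984, Ch. 7 §2 p. 306] -/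
theorem l1_V_le (j m i k : ℕ) :
    l1 (V j m i k) ≤ (7 * ((i : ℝ) + k + j)) ^ j * ((m : ℝ) + 1) ^ (i + k + j) := by
  unfold V D₀
  set Q : R₇ := X (Sum.inl 0) ^ i * X (Sum.inl 1) ^ k with hQ
  set P : R₇ := ((MvPolynomial.mkDerivation ℤ dval).toLinearMap ^ j) Q with hP
  have hM : (1 : ℝ) ≤ (m : ℝ) + 1 := by linarith [(Nat.cast_nonneg m : (0 : ℝ) ≤ m)]
  have hQdeg0 : Q.totalDegree ≤ i + k := totalDegree_monomial_ik i k
  have hdegP : P.totalDegree ≤ i + k + j := by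
    refine (totalDegree_mkDerivation_pow_le dval totalDegree_dval_le j _).trans ?_
    omega
  have hl1P : l1 P ≤ (7 * ((i : ℝ) + k + j)) ^ j := by
    refine (l1_mkDerivation_pow_le dval (by norm_num) l1_dval_le totalDegree_dval_le j Q).trans ?_
    have hQdeg : (Q.totalDegree : ℝ) ≤ i + k := by exact_mod_cast totalDegree_monomial_ik i k
    have hQl1 : l1 Q ≤ 1 := l1_monomial_ik i k
    have h0 : 0 ≤ (7 * ((Q.totalDegree : ℝ) + j)) ^ j := by positivity
    calc (7 * ((Q.totalDegree : ℝ) + j)) ^ j * l1 Q ≤ (7 * ((Q.totalDegree : ℝ) + j)) ^ j * 1 := by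
          gcongr
      _ ≤ (7 * ((i : ℝ) + k + j)) ^ j := by
          rw [mul_one]
          have h7 : 7 * ((Q.totalDegree : ℝ) + j) ≤ 7 * ((i : ℝ) + k + j) := by linarith
          exact pow_le_pow_left₀ (by positivity) h7 j
  calc l1 (MvPolynomial.aeval (sval m) P) ≤ l1 P * ((m : ℝ) + 1) ^ P.totalDegree :=
        l1_aeval_le _ hM (l1_sval_le m) P
    _ ≤ (7 * ((i : ℝ) + k + j)) ^ j * ((m : ℝ) + 1) ^ (i + k + j) :=
        mul_le_mul hl1P (pow_le_pow_right₀ hM hdegP) (by positivity) (by positivity)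

end Literature.NumberTheory.Transcendental.Chudnovsky

end
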